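import Summits.QuantumFields.YangMills.Theorems.BalabanUVNodesN15PartitionLattice
import HarnessLib

/-!
# THE QUADRATIC PARTITION OF UNITY (2.36), IV: the TWO-GRID FIT OF THE FIRST DERIVATIVE — `|∇′_μh′_k(x′) − ∇_μh_k(πx′)| ≤ (64 + |J|)π²·|ns|·s` (`= (64+|J|)π²∕(nM²)` at `s = 1∕(nM)`) for the
# sampled partitions at two spacings with `s = L·s′`, `n·s = n′·s′` and fine points offset from their coarse images by `i·s′`, `0 ≤ i ≤ L` — by DISCRETE telescoping of difference
# quotients against FILE 60's second-difference letter, no calculus (dag-n15-c g11, FILE 64; FILE 46's `hf1`∕`hf1b` input `o₁`; N15 = NE2, s1 «background-layer OPERATOR ingredient»)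

Cell `pub-ymgap`, seat `pub-ymgap-dag-n15-c` (R134 (a); HUMAN RULING D-0062), generation 11.  `bears_on: R4∕N15 · K3⁷ SpineGivenEndpointR13SepCoPH (stmt-QuantumFields-20544)`.
Filed `--supports stmt-QuantumFields-20544 --as helper` — COUNT-NEUTRAL.  Theorems only (0 `def`, 0 `sorry`).  Imports BY NAME FILE 61 `…N15PartitionLattice` (`hcube`, `hcube_shift`, `prod_shift_eq`,
`hcube_eq_mul`, `prod_erase_mem`, `abs_prod_sub_prod_le`; FILE 60 `thetaPer`, `abs_thetaPer_second_diff_le`, `abs_thetaPer_sub_le`, `thetaPer_add_int_mul`; g8 `fgrad`).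

WHY.  FILE 46 `hasMaj_idef_commOp_lapOp_comp` (the η-defect of the (2.134) row) displays the fits `o₁ : |∇′h′ − (∇h)∘π| ≤ o₁` (and `o₂` for `∇*∇`).  For the sampled partition `h = hcube`
(FILE 61) at two spacings — coarse step `s`, fine step `s′ = s∕L`, inverse spacings with `ns = n′s′ = κ` (`= M⁻¹`) — the difference quotients compare through the TELESCOPE
`Θ(u + Ls′) − Θ(u) = Σ_{j<L}[Θ(u + (j+1)s′) − Θ(u + js′)]` and the drift of the one-step difference `|D(v + ps′) − D(v)| ≤ p·32π²s′²` (FILE 60's second difference, `p` times):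
★ `abs_diff_thetaPer_shift_le` (the drift), ★ `thetaPer_telescope`, ★★ `abs_dq_thetaPer_sub_le` — `|n′(Θ_K(u′+s′) − Θ_K(u′)) − n(Θ_K(u+s) − Θ_K(u))| ≤ 64π²|κ|s` for `u′ = u + is′ + zK`, `0 ≤ i ≤ L`;
★★★ `abs_fgrad_hcube_two_grid_le` — on the product carriers: `|fgrad n′ (e′ μ) (hcube K ξ′ k) x′ − fgrad n (e μ) (hcube K ξ k) (πx′)| ≤ |κ|·s·(64π² + π²·|J|)` from the coordinate offsets
`ξ′_ν x′ = ξ_ν(πx′) + i_ν s′ (mod K)`, `0 ≤ i_ν ≤ L` (the other coordinates contribute `π·Σ|v_K(ξ′_ν − ξ_ν∘π)| ≤ π|J|s` against `|∇h| ≤ |n|πs`).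

HONEST FRAMING ∕ LIMITS.  Elementary; (2.36) p.229 + [B9] Thm 3.14's difference template = SHAPES; the second-derivative fit `o₂` (a third-difference letter of `Θ`) is NOT in this file.
Nothing of [B6]∕[B9] asserted.  NE2⁺ NOT PRINTED, NOT proved; N15 NOT discharged; counts of record UNMOVED (typed 28∕28 · discharged 5∕27); one finite 𝕋⁴ at fixed ε — NOT infinite
volume, NOT OS on ℝ⁴, NOT a mass gap, NOT Clay; R4 closes the conditional finite-𝕋⁴ rung `BalabanLadder.UV` only.  Restate-immune (no Theses import).
-/

noncomputable section

namespace Summit.QuantumFields.YangMills.BalabanUVNodes.N15.Gluing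

open Real
open Summit.QuantumFields.YangMills.BalabanUVNodes.N15.BackgroundLayer (fgrad fgrad_apply)

/-! ## §1 One coordinate: drift of the one-step difference, telescope, the difference-quotient fit -/

section OneDim

variable {K : ℕ}

/-- ★ **DRIFT OF THE ONE-STEP DIFFERENCE**: `D(w) := Θ_K(w + s′) − Θ_K(w)` moves by at most `32π²s′²` per step: `|D(v + ps′) − D(v)| ≤ p·32π²s′²` (`0 ≤ s′ ≤ 1`, `K ≥ 2`). [folklore] -/
theorem abs_diff_thetaPer_shift_le (hK : 2 ≤ K) {s' : ℝ} (hs : 0 ≤ s') (hs1 : s' ≤ 1) (v : ℝ) (p : ℕ) :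
    |(thetaPer K (v + p * s' + s') - thetaPer K (v + p * s')) - (thetaPer K (v + s') - thetaPer K v)| ≤ p * (32 * π ^ 2 * s' ^ 2) := by
  induction p with
  | zero => simp
  | succ p ih =>
      have step := abs_thetaPer_second_diff_le (u := v + p * s' + s') hK hs hs1
      rw [show v + p * s' + s' - s' = v + p * s' by ring] at step
      push_cast
      calc |thetaPer K (v + (p + 1) * s' + s') - thetaPer K (v + (p + 1) * s') - (thetaPer K (v + s') - thetaPer K v)|
          = |(thetaPer K (v + p * s' + s' + s') - 2 * thetaPer K (v + p * s' + s') + thetaPer K (v + p * s')) +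
              ((thetaPer K (v + p * s' + s') - thetaPer K (v + p * s')) - (thetaPer K (v + s') - thetaPer K v))| := by ring_nf
        _ ≤ 32 * π ^ 2 * s' ^ 2 + p * (32 * π ^ 2 * s' ^ 2) := (abs_add_le _ _).trans (add_le_add step ih)
        _ = (p + 1) * (32 * π ^ 2 * s' ^ 2) := by ring

/-- ★ **TELESCOPE**: `Θ_K(u + Ls′) − Θ_K(u) = Σ_{j<L} [Θ_K(u + js′ + s′) − Θ_K(u + js′)]`. [folklore] -/
theorem thetaPer_telescope (u s' : ℝ) (L : ℕ) : thetaPer K (u + L * s') - thetaPer K u = ∑ j ∈ Finset.range L, (thetaPer K (u + j * s' + s') - thetaPer K (u + j * s')) := by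
  induction L with
  | zero => simp
  | succ L ih =>
      rw [Finset.sum_range_succ, ← ih]
      push_cast
      ring_nf

/-- ★★ **THE DIFFERENCE-QUOTIENT FIT**: `s = Ls′`, `ns = n′s′ = κ`, `u′ = u + is′ + zK` with `0 ≤ i ≤ L`, `0 ≤ s′ ≤ 1`, `K ≥ 2` ⟹
`|n′(Θ_K(u′ + s′) − Θ_K(u′)) − n(Θ_K(u + s) − Θ_K(u))| ≤ 64π²·|κ|·s`. [cite: Balaban1985BackgroundPropagators, Thm 3.14 pp.426–427 (difference template: shape)] -/
theorem abs_dq_thetaPer_sub_le (hK : 2 ≤ K) {s s' κ n n' u u' : ℝ} {L : ℕ} {i : ℕ} {z : ℤ} (hL : 1 ≤ L) (hs : 0 ≤ s') (hs1 : s' ≤ 1) (hsL : s = L * s') (hn : n * s = κ) (hn' : n' * s' = κ)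
    (hi : i ≤ L) (hu' : u' = u + i * s' + z * K) :
    |n' * (thetaPer K (u' + s') - thetaPer K u') - n * (thetaPer K (u + s) - thetaPer K u)| ≤ 64 * π ^ 2 * |κ| * s := by
  have hK0 : 0 < K := by omega
  have hLr : (1 : ℝ) ≤ L := by exact_mod_cast hL
  have hLpos : (0 : ℝ) < L := by linarith
  -- remove the period
  have e1 : thetaPer K (u' + s') = thetaPer K (u + i * s' + s') := by
    rw [hu', show u + i * s' + z * K + s' = (u + i * s' + s') + z * K by ring, thetaPer_add_int_mul hK0]
  have e2 : thetaPer K u' = thetaPer K (u + i * s') := by rw [hu', thetaPer_add_int_mul hK0]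
  rw [e1, e2, hsL, thetaPer_telescope]
  -- n = κ/(L s'), n' = κ/s' (when s' ≠ 0); the degenerate s' = 0 case is trivial
  rcases eq_or_lt_of_le hs with hs0 | hs0
  · rw [← hs0]; simp
  have hn_eq : n = κ / (L * s') := by rw [← hn, hsL]; field_simp
  have hn'_eq : n' = κ / s' := by rw [← hn']; field_simp
  obtain ⟨D, hD⟩ : ∃ D : ℕ → ℝ, ∀ j : ℕ, thetaPer K (u + j * s' + s') - thetaPer K (u + j * s') = D j := ⟨_, fun _ => rfl⟩
  have hC : 0 ≤ 32 * π ^ 2 * s' ^ 2 := by positivity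
  have hdrift : ∀ j : ℕ, j < L → |D i - D j| ≤ 2 * L * (32 * π ^ 2 * s' ^ 2) := by
    intro j hj
    have a := abs_diff_thetaPer_shift_le hK hs0.le hs1 u j
    have b := abs_diff_thetaPer_shift_le hK hs0.le hs1 u i
    rw [hD j] at a
    rw [hD i] at b
    have hj' : (j : ℝ) ≤ L := by exact_mod_cast hj.le
    have hi' : (i : ℝ) ≤ L := by exact_mod_cast hi
    calc |D i - D j| ≤ |D i - (thetaPer K (u + s') - thetaPer K u)| + |(thetaPer K (u + s') - thetaPer K u) - D j| := abs_sub_le _ _ _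
      _ ≤ i * (32 * π ^ 2 * s' ^ 2) + j * (32 * π ^ 2 * s' ^ 2) := add_le_add b (by rw [abs_sub_comm]; exact a)
      _ ≤ 2 * L * (32 * π ^ 2 * s' ^ 2) := by nlinarith
  simp only [hD]
  have key : n' * D i - n * ∑ j ∈ Finset.range L, D j = (κ / (L * s')) * ∑ j ∈ Finset.range L, (D i - D j) := by
    rw [hn_eq, hn'_eq, Finset.sum_sub_distrib, Finset.sum_const, Finset.card_range, nsmul_eq_mul]
    field_simp
  have hsum : |∑ j ∈ Finset.range L, (D i - D j)| ≤ L * (2 * L * (32 * π ^ 2 * s' ^ 2)) := by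
    refine (Finset.abs_sum_le_sum_abs _ _).trans ?_
    calc ∑ j ∈ Finset.range L, |D i - D j| ≤ ∑ j ∈ Finset.range L, 2 * L * (32 * π ^ 2 * s' ^ 2) :=
          Finset.sum_le_sum fun j hj => hdrift j (Finset.mem_range.1 hj)
      _ = L * (2 * L * (32 * π ^ 2 * s' ^ 2)) := by rw [Finset.sum_const, Finset.card_range, nsmul_eq_mul]
  rw [key, abs_mul, abs_div, abs_mul, abs_of_pos hLpos, abs_of_pos hs0]
  calc |κ| / (L * s') * |∑ j ∈ Finset.range L, (D i - D j)| ≤ |κ| / (L * s') * (L * (2 * L * (32 * π ^ 2 * s' ^ 2))) :=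
        mul_le_mul_of_nonneg_left hsum (by positivity)
    _ = 64 * π ^ 2 * |κ| * (L * s') := by field_simp; ring

end OneDim

/-! ## §2 The product carriers: FILE 46's `o₁` -/

section Lattice

variable {X X' : Type} {J : Type} [Fintype J] [DecidableEq J] (K : ℕ) (ξ : J → X → ℝ) (ξ' : J → X' → ℝ) (pr : X' → X) (e : J → X ≃ X) (e' : J → X' ≃ X')

/-- ★★★ **THE TWO-GRID FIT OF `∇h`** (FILE 46's `hf1` with `o₁ = |κ|·s·(64 + |J|)π²`, `κ = ns = n′s′`, i.e. `o₁ = (64 + |J|)π²∕(nM²)` at `s = 1∕(nM)`): coarse∕fine coordinates with the shift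
compatibilities, `s = Ls′`, `0 ≤ s′ ≤ 1`, `K ≥ 2`, and every fine coordinate offset from its coarse image by `i_ν s′ (mod K)` with `0 ≤ i_ν ≤ L` ⟹
`|fgrad n′ (e′ μ) (hcube K ξ′ k) x′ − fgrad n (e μ) (hcube K ξ k) (πx′)| ≤ |κ|·s·(64π² + π²|J|)`. [cite: Balaban1984PropagatorsII, (2.36) p.229; Balaban1985BackgroundPropagators, Thm 3.14 pp.426–427 (difference template)] -/
theorem abs_fgrad_hcube_two_grid_le (hK : 2 ≤ K) {s s' κ n n' : ℝ} {L : ℕ} (hL : 1 ≤ L) (hs : 0 ≤ s') (hs1 : s' ≤ 1) (hsL : s = L * s') (hn : n * s = κ) (hn' : n' * s' = κ)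
    (hξ : ∀ μ ν x, ∃ z : ℤ, ξ ν (e μ x) = ξ ν x + (if ν = μ then s else 0) + z * K) (hξ' : ∀ μ ν x', ∃ z : ℤ, ξ' ν (e' μ x') = ξ' ν x' + (if ν = μ then s' else 0) + z * K)
    (hoff : ∀ ν x', ∃ i : ℕ, i ≤ L ∧ ∃ z : ℤ, ξ' ν x' = ξ ν (pr x') + i * s' + z * K) (k : J → ZMod K) (μ : J) (x' : X') :
    |fgrad n' (e' μ) (hcube K ξ' k) x' - fgrad n (e μ) (hcube K ξ k) (pr x')| ≤ |κ| * s * (64 * π ^ 2 + π ^ 2 * Fintype.card J) := by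
  have hK0 : 0 < K := by omega
  have hsnn : 0 ≤ s := by rw [hsL]; positivity
  rw [fgrad_apply, fgrad_apply, hcube_shift K ξ' e' hK0 hξ', prod_shift_eq, hcube_eq_mul K ξ' k μ x', hcube_shift K ξ e hK0 hξ, prod_shift_eq, hcube_eq_mul K ξ k μ (pr x')]
  have regroup : ∀ n₁ n₂ A₁ B₁ A₂ B₂ P₁ P₂ : ℝ, n₁ * (A₁ * P₁ - B₁ * P₁) - n₂ * (A₂ * P₂ - B₂ * P₂) = (n₁ * (A₁ - B₁) - n₂ * (A₂ - B₂)) * P₁ + n₂ * (A₂ - B₂) * (P₁ - P₂) := by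
    intros; ring
  rw [regroup]
  -- the two complementary products
  have hP' := prod_erase_mem K ξ' k μ x'
  have hP := prod_erase_mem K ξ k μ (pr x')
  -- first term: the one-coordinate difference-quotient fit
  obtain ⟨i, hi, z, hz⟩ := hoff μ x'
  have hu' : ξ' μ x' - ((k μ).val : ℝ) = (ξ μ (pr x') - ((k μ).val : ℝ)) + i * s' + z * K := by rw [hz]; ring
  have t1 := abs_dq_thetaPer_sub_le hK hL hs hs1 hsL hn hn' hi hu'
  rw [show ξ μ (pr x') - ((k μ).val : ℝ) + s = ξ μ (pr x') + s - ((k μ).val : ℝ) by ring, show ξ' μ x' - ((k μ).val : ℝ) + s' = ξ' μ x' + s' - ((k μ).val : ℝ) by ring] at t1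
  -- second term: the coarse difference times the drift of the other coordinates
  have hΔ : |thetaPer K (ξ μ (pr x') + s - ((k μ).val : ℝ)) - thetaPer K (ξ μ (pr x') - ((k μ).val : ℝ))| ≤ π * s := by
    refine (abs_thetaPer_sub_le hK0 _ _).trans (le_of_eq ?_)
    rw [show ξ μ (pr x') + s - ((k μ).val : ℝ) - (ξ μ (pr x') - ((k μ).val : ℝ)) = s by ring, abs_of_nonneg hsnn]
  have hPP : |(∏ ν ∈ Finset.univ.erase μ, thetaPer K (ξ' ν x' - ((k ν).val : ℝ))) - ∏ ν ∈ Finset.univ.erase μ, thetaPer K (ξ ν (pr x') - ((k ν).val : ℝ))| ≤ Fintype.card J * (π * s) := by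
    refine (abs_prod_sub_prod_le (Finset.univ.erase μ) _ _ (fun ν => ⟨thetaPer_nonneg K _, (le_abs_self _).trans (abs_thetaPer_le_one K _)⟩)
      (fun ν => ⟨thetaPer_nonneg K _, (le_abs_self _).trans (abs_thetaPer_le_one K _)⟩)).trans ?_
    have hterm : ∀ ν ∈ Finset.univ.erase μ, |thetaPer K (ξ' ν x' - ((k ν).val : ℝ)) - thetaPer K (ξ ν (pr x') - ((k ν).val : ℝ))| ≤ π * s := by
      intro ν _
      obtain ⟨iν, hiν, zν, hzν⟩ := hoff ν x'
      rw [hzν, show ξ ν (pr x') + iν * s' + zν * K - ((k ν).val : ℝ) = (ξ ν (pr x') + iν * s' - ((k ν).val : ℝ)) + zν * K by ring, thetaPer_add_int_mul hK0]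
      refine (abs_thetaPer_sub_le hK0 _ _).trans ?_
      rw [show ξ ν (pr x') + iν * s' - ((k ν).val : ℝ) - (ξ ν (pr x') - ((k ν).val : ℝ)) = iν * s' by ring, abs_of_nonneg (by positivity)]
      have : (iν : ℝ) * s' ≤ L * s' := mul_le_mul_of_nonneg_right (by exact_mod_cast hiν) hs
      rw [hsL]; exact mul_le_mul_of_nonneg_left this Real.pi_pos.le
    calc ∑ ν ∈ Finset.univ.erase μ, |thetaPer K (ξ' ν x' - ((k ν).val : ℝ)) - thetaPer K (ξ ν (pr x') - ((k ν).val : ℝ))|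
        ≤ ∑ ν ∈ Finset.univ.erase μ, π * s := Finset.sum_le_sum hterm
      _ = (Finset.univ.erase μ).card * (π * s) := by rw [Finset.sum_const, nsmul_eq_mul]
      _ ≤ Fintype.card J * (π * s) := by
          refine mul_le_mul_of_nonneg_right ?_ (by positivity)
          exact_mod_cast (Finset.card_erase_le).trans (Finset.card_univ (α := J)).le
  have hns : |n| * s = |κ| := by rw [← hn, abs_mul, abs_of_nonneg hsnn]
  refine (abs_add_le _ _).trans ?_
  rw [abs_mul, abs_mul, abs_mul, abs_of_nonneg hP'.1]
  have b1 : |n' * (thetaPer K (ξ' μ x' + s' - ((k μ).val : ℝ)) - thetaPer K (ξ' μ x' - ((k μ).val : ℝ))) -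
      n * (thetaPer K (ξ μ (pr x') + s - ((k μ).val : ℝ)) - thetaPer K (ξ μ (pr x') - ((k μ).val : ℝ)))| *
      ∏ ν ∈ Finset.univ.erase μ, thetaPer K (ξ' ν x' - ((k ν).val : ℝ)) ≤ 64 * π ^ 2 * |κ| * s := (mul_le_of_le_one_right (abs_nonneg _) hP'.2).trans t1
  have b2 : |n| * |thetaPer K (ξ μ (pr x') + s - ((k μ).val : ℝ)) - thetaPer K (ξ μ (pr x') - ((k μ).val : ℝ))| *
      |(∏ ν ∈ Finset.univ.erase μ, thetaPer K (ξ' ν x' - ((k ν).val : ℝ))) - ∏ ν ∈ Finset.univ.erase μ, thetaPer K (ξ ν (pr x') - ((k ν).val : ℝ))| ≤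
      |n| * (π * s) * (Fintype.card J * (π * s)) := mul_le_mul (mul_le_mul_of_nonneg_left hΔ (abs_nonneg _)) hPP (abs_nonneg _) (by positivity)
  calc _ ≤ 64 * π ^ 2 * |κ| * s + |n| * (π * s) * (Fintype.card J * (π * s)) := add_le_add b1 b2
    _ = |κ| * s * (64 * π ^ 2 + π ^ 2 * Fintype.card J) := by rw [← hns]; ring

end Lattice

end Summit.QuantumFields.YangMills.BalabanUVNodes.N15.Gluing

end
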